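import Mathlib
import HarnessLib
import Summits.Ventures.LatticeQCDFlow.Exactness.WoodEnvelope
import Summits.Ventures.LatticeQCDFlow.Exactness.RejectionSampling

/-!
# Wood's von Mises–Fisher rejection loop is exact: the output has density `∝ (1−w²)^{(d−3)/2} e^{κw}`

HONEST FRAMING: exact (Metropolis-corrected) sampling algorithms for lattice gauge theory;
figures of merit are autocorrelation/cost numbers at stated couplings and volumes; no
continuum-physics claim.

Venture `LatticeQCDFlow` (cell pub-lqcd), topic `Exactness`, FANOUT row 9 (eng-latcore, the
engine `latflow.core`).  NEW WORK of the cell over Mathlib (`betaMeasure`,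
`lintegral_image_eq_lintegral_abs_deriv_mul`) and row 9's `WoodEnvelope.lean` (the acceptance
exponent is a thinning) and `RejectionSampling.lean` (`loopLaw_thinning`).  Nothing is cited as a
fact.  Printed counterpart, NAMED ONLY: Wood 1994.

The CP(N−1) site heat bath of `latflow.core` (`cpn_2d.py` `sample_vmf_cos`, C `rng_vmf_w`), one
round, with `α = δ/2`, `δ = d − 1`, `b = woodB κ δ`: draw `Z ∼ Beta(α, α)`, form
`W = (1 − (1+b)Z)/(1 − (1−b)Z)`, accept iff `κW + δ log(1 − x₀W) − c ≥ log U`.  TAKING THE BETA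
DRAW AS A PRIMITIVE (numpy `rng.beta`; C: two Marsaglia–Tsang gammas), in idealised arithmetic:

* `woodD`, `woodW`, `woodZ` — the Möbius map of the engine and its inverse on `(0,1) ↔ (−1,1)`
  (`woodW_woodZ`, `image_woodZ`, `hasDerivAt_woodZ`);
* **`lintegral_woodW`** — the proposal law: for measurable `g ≥ 0`,
  `∫ g(W z) dBeta(α,α)(z) = ∫_{(−1,1)} betaPDF(Z(w)) · 2b/D(w)² · g(w) dw`, `D(w) = (1+b) − (1−b)w`;
* `woodAccept κ δ w = min(e^{h(w)−c}, 1)` (the engine's test), `woodRound`, `vmfCosLaw κ δ` = the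
  law `(1−w²)^{δ/2−1} e^{κw} dw` on `(−1,1)`; **`wood_pointwise`** — on `(−1,1)` the proposal
  density times the acceptance probability is `woodConst κ δ ×` that density (all `D`-powers
  cancel — the content of Wood's construction), proved in logarithms;
* **`loopLaw_woodRound`** — THE LOOP IS EXACT: for `κ ≥ 0`, `δ > 0` it outputs
  `(vmfCosLaw κ δ ℝ)⁻¹ • vmfCosLaw κ δ`, and accepts with probability `woodConst · mass` per round
  (`woodRound_accept`).

NOT CLAIMED: the identification of `vmfCosLaw κ (d−1)` with the law of `m·x` under the von
Mises–Fisher law on `S^{d−1}` (row 7's `SphereAxisDisintegration.lean` gives the `κ = 0` case,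
`∝ sin^{d−2}θ dθ`); the Beta / Gamma generators; the perpendicular direction (uniform on the
sub-sphere, Muller); floating point and the round cap `it < 1000000`.
-/

namespace Summit.Ventures.LatticeQCDFlow.Exactness

open MeasureTheory Measure Set Real ProbabilityTheory
open scoped ENNReal

section WoodLoop

variable {κ δ b : ℝ}

/-! ## §1 The Möbius proposal map and its inverse -/

/-- `D(w) = (1 + b) − (1 − b) w`. -/
noncomputable def woodD (b w : ℝ) : ℝ := (1 + b) - (1 - b) * w

/-- The engine's proposal map `W(z) = (1 − (1+b)z)/(1 − (1−b)z)`. -/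
noncomputable def woodW (b z : ℝ) : ℝ := (1 - (1 + b) * z) / (1 - (1 - b) * z)

/-- Its inverse `Z(w) = (1 − w)/D(w)`. -/
noncomputable def woodZ (b w : ℝ) : ℝ := (1 - w) / woodD b w

/-- `D(w) ≥ 2b > 0` for `w ≤ 1` (`0 < b ≤ 1`). -/
theorem woodD_pos (hb : 0 < b) (hb1 : b ≤ 1) {w : ℝ} (hw : w ≤ 1) : 0 < woodD b w := by
  rw [woodD]; nlinarith

/-- `Z(w) ∈ (0, 1)` for `w ∈ (−1, 1)`. -/
theorem woodZ_mem (hb : 0 < b) (hb1 : b ≤ 1) {w : ℝ} (hw : w ∈ Ioo (-1 : ℝ) 1) :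
    woodZ b w ∈ Ioo (0 : ℝ) 1 := by
  have hD := woodD_pos hb hb1 hw.2.le
  refine ⟨div_pos (by linarith [hw.2]) hD, (div_lt_one hD).mpr ?_⟩
  rw [woodD]; nlinarith [hw.1]

/-- `1 − Z(w) = b(1 + w)/D(w)`. -/
theorem one_sub_woodZ (hb : 0 < b) (hb1 : b ≤ 1) {w : ℝ} (hw : w ≤ 1) :
    1 - woodZ b w = b * (1 + w) / woodD b w := by
  have hD := (woodD_pos hb hb1 hw).ne'
  rw [woodZ, eq_div_iff hD, sub_mul, div_mul_cancel₀ _ hD, woodD]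
  ring

/-- `W(Z(w)) = w` on `(−1, 1)`. -/
theorem woodW_woodZ (hb : 0 < b) (hb1 : b ≤ 1) {w : ℝ} (hw : w ∈ Ioo (-1 : ℝ) 1) :
    woodW b (woodZ b w) = w := by
  have hD : (1 + b) - (1 - b) * w ≠ 0 := by have := woodD_pos hb hb1 hw.2.le; rw [woodD] at this; exact this.ne'
  have h2b : (2 : ℝ) * b ≠ 0 := by positivity
  have h1 : 1 - (1 + b) * woodZ b w = 2 * b * w / ((1 + b) - (1 - b) * w) := by
    rw [woodZ, woodD, mul_div_assoc', one_sub_div hD]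
    congr 1; ring
  have h2 : 1 - (1 - b) * woodZ b w = 2 * b / ((1 + b) - (1 - b) * w) := by
    rw [woodZ, woodD, mul_div_assoc', one_sub_div hD]
    congr 1; ring
  rw [woodW, h1, h2, div_div_div_cancel_right₀ hD, mul_div_cancel_left₀ w h2b]

/-- `W(z) ∈ (−1, 1)` and `Z(W(z)) = z` for `z ∈ (0, 1)`. -/
theorem woodW_mem_and_woodZ_woodW (hb : 0 < b) {z : ℝ} (hz : z ∈ Ioo (0 : ℝ) 1) :
    woodW b z ∈ Ioo (-1 : ℝ) 1 ∧ woodZ b (woodW b z) = z := by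
  have hden : 0 < 1 - (1 - b) * z := by nlinarith [hz.1, hz.2]
  have hW1 : woodW b z < 1 := by
    rw [woodW, div_lt_one hden]; nlinarith [hz.1]
  have hW2 : -1 < woodW b z := by
    rw [woodW, lt_div_iff₀ hden]; nlinarith [hz.2]
  refine ⟨⟨hW2, hW1⟩, ?_⟩
  have hM : 1 - (1 - b) * z ≠ 0 := hden.ne'
  have h2b : (2 : ℝ) * b ≠ 0 := by positivity
  have h1 : 1 - woodW b z = 2 * b * z / (1 - (1 - b) * z) := by
    rw [woodW, one_sub_div hM]
    congr 1; ring
  have h2 : woodD b (woodW b z) = 2 * b / (1 - (1 - b) * z) := by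
    rw [woodD, woodW, mul_div_assoc', sub_div' hM]
    congr 1; ring
  rw [woodZ, h1, h2, div_div_div_cancel_right₀ hM, mul_div_cancel_left₀ z h2b]

/-- `Z` maps `(−1, 1)` onto `(0, 1)`. -/
theorem image_woodZ (hb : 0 < b) (hb1 : b ≤ 1) : woodZ b '' Ioo (-1) 1 = Ioo 0 1 := by
  ext z
  constructor
  · rintro ⟨w, hw, rfl⟩; exact woodZ_mem hb hb1 hw
  · intro hz
    obtain ⟨hW, hZW⟩ := woodW_mem_and_woodZ_woodW hb hz
    exact ⟨woodW b z, hW, hZW⟩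

/-- Derivative of `Z`: `−2b/D(w)²`. -/
theorem hasDerivAt_woodZ (hb : 0 < b) (hb1 : b ≤ 1) {w : ℝ} (hw : w ≤ 1) :
    HasDerivAt (woodZ b) (-(2 * b) / woodD b w ^ 2) w := by
  have hD := (woodD_pos hb hb1 hw).ne'
  have hnum : HasDerivAt (fun w : ℝ => 1 - w) (-1) w := by
    simpa using (hasDerivAt_id w).const_sub 1
  have hden : HasDerivAt (woodD b) (-(1 - b)) w := by
    have h1 : HasDerivAt (fun x : ℝ => (1 + b) - (1 - b) * x) (0 - (1 - b) * 1) w :=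
      (hasDerivAt_const w (1 + b)).sub ((hasDerivAt_id w).const_mul (1 - b))
    have h2 : (fun x : ℝ => (1 + b) - (1 - b) * x) = woodD b := funext fun x => rfl
    rw [h2] at h1
    convert h1 using 1
    ring
  have h := hnum.div hden hD
  have h3 : ((fun x : ℝ => 1 - x) / woodD b) = woodZ b := funext fun x => rfl
  have hval : -1 * woodD b w - (1 - w) * -(1 - b) = -(2 * b) := by rw [woodD]; ring
  rw [h3, hval] at h
  exact h

/-- `woodW b` is measurable. -/
theorem measurable_woodW (b : ℝ) : Measurable (woodW b) := by
  unfold woodW; fun_prop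

/-! ## §2 The law of the proposal `W(Z)`, `Z ∼ Beta(α, α)` -/

/-- **The proposal law.**  For `0 < b ≤ 1`, any `α` and measurable `g ≥ 0`:
`∫ g(W z) dBeta(α,α)(z) = ∫_{(−1,1)} betaPDF_{α,α}(Z(w)) · 2b/D(w)² · g(w) dw`. -/
theorem lintegral_woodW (hb : 0 < b) (hb1 : b ≤ 1) {α : ℝ} {g : ℝ → ℝ≥0∞} (hg : Measurable g) :
    ∫⁻ z, g (woodW b z) ∂(betaMeasure α α) =
      ∫⁻ w in Ioo (-1) 1, ENNReal.ofReal (betaPDFReal α α (woodZ b w) * (2 * b / woodD b w ^ 2)) * g w := by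
  have hpdf : Measurable (betaPDF α α) := (measurable_betaPDFReal α α).ennreal_ofReal
  rw [betaMeasure, lintegral_withDensity_eq_lintegral_mul _ (g := fun z => g (woodW b z)) hpdf
    (hg.comp (measurable_woodW b))]
  -- the integrand vanishes off `(0, 1)`
  have hsupp : (Function.support fun z => (betaPDF α α * fun z => g (woodW b z)) z) ⊆ Ioo 0 1 := by
    intro z hz
    rw [Function.mem_support, Pi.mul_apply] at hz
    by_contra h
    rw [mem_Ioo, not_and_or, not_lt, not_lt] at h
    rcases h with h | h
    · exact hz (by rw [betaPDF_eq_zero_of_nonpos h, zero_mul])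
    · exact hz (by rw [betaPDF_eq_zero_of_one_le h, zero_mul])
  rw [← setLIntegral_eq_of_support_subset hsupp, ← image_woodZ hb hb1,
    lintegral_image_eq_lintegral_abs_deriv_mul measurableSet_Ioo
      (fun w hw => (hasDerivAt_woodZ hb hb1 (le_of_lt hw.2)).hasDerivWithinAt)
      (fun w₁ h₁ w₂ h₂ heq => by
        rw [← woodW_woodZ hb hb1 h₁, ← woodW_woodZ hb hb1 h₂, heq])]
  refine setLIntegral_congr_fun measurableSet_Ioo fun w hw => ?_
  have hZ := woodZ_mem hb hb1 hw
  have hD := woodD_pos hb hb1 hw.2.le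
  rw [Pi.mul_apply, woodW_woodZ hb hb1 hw, betaPDF,
    abs_of_neg (div_neg_of_neg_of_pos (by linarith) (by positivity)), neg_div, neg_neg, ← mul_assoc,
    ← ENNReal.ofReal_mul (by positivity), mul_comm (2 * b / woodD b w ^ 2)]

/-! ## §3 The acceptance test and the pointwise identity -/

/-- The probability that the engine's test `h(W) − c ≥ log U` accepts the proposed `w`. -/
noncomputable def woodAccept (κ δ w : ℝ) : ℝ≥0∞ :=
  ENNReal.ofReal (min (Real.exp (woodH κ δ w - woodC κ δ)) 1)

/-- `woodAccept` is measurable. -/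
theorem measurable_woodAccept (κ δ : ℝ) : Measurable (woodAccept κ δ) := by
  unfold woodAccept woodH; fun_prop

/-- `woodAccept ≤ 1`. -/
theorem woodAccept_le_one (κ δ w : ℝ) : woodAccept κ δ w ≤ 1 :=
  ENNReal.ofReal_le_one.mpr (min_le_right _ _)

/-- On `[−1, 1]` the acceptance probability is `exp(h(w) − c)` (`WoodEnvelope.wood_accept_le_one`). -/
theorem woodAccept_eq (hκ : 0 ≤ κ) (hδ : 0 < δ) {w : ℝ} (hw : w ∈ Icc (-1 : ℝ) 1) :
    woodAccept κ δ w = ENNReal.ofReal (Real.exp (woodH κ δ w - woodC κ δ)) := by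
  rw [woodAccept, min_eq_left (wood_accept_le_one hκ hδ hw)]

/-- The target law: density `(1 − w²)^{δ/2 − 1} e^{κ w}` on `(−1, 1)` (`δ = d − 1`: the cosine marginal
of the von Mises–Fisher law on `S^{d−1}`, unnormalised). -/
noncomputable def vmfCosLaw (κ δ : ℝ) : Measure ℝ :=
  (volume.restrict (Ioo (-1) 1)).withDensity fun w => ENNReal.ofReal ((1 - w ^ 2) ^ (δ / 2 - 1) * Real.exp (κ * w))

/-- Wood's constant `K = (2/B(α,α)) · exp(α log b − c − δ log(1+b))`, `α = δ/2`. -/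
noncomputable def woodConst (κ δ : ℝ) : ℝ≥0∞ :=
  ENNReal.ofReal (2 / beta (δ / 2) (δ / 2) *
    Real.exp (δ / 2 * Real.log (woodB κ δ) - woodC κ δ - δ * Real.log (1 + woodB κ δ)))

/-- `K ≠ 0`. -/
theorem woodConst_ne_zero (hδ : 0 < δ) : woodConst κ δ ≠ 0 := by
  rw [woodConst, Ne, ENNReal.ofReal_eq_zero, not_le]
  have := beta_pos (by positivity : 0 < δ / 2) (by positivity : 0 < δ / 2)
  positivity

/-- Bookkeeping: four exponentials times `2/B`. -/
theorem exp_combine4 (B P₁ P₂ P₃ P₄ : ℝ) :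
    1 / B * Real.exp P₁ * Real.exp P₂ * (2 * Real.exp P₃) * Real.exp P₄ = 2 / B * Real.exp (P₁ + P₂ + P₃ + P₄) := by
  rw [Real.exp_add, Real.exp_add, Real.exp_add]; ring

/-- Bookkeeping: three exponentials times `2/B`. -/
theorem exp_combine3 (B P₅ P₆ P₇ : ℝ) :
    2 / B * Real.exp P₅ * (Real.exp P₆ * Real.exp P₇) = 2 / B * Real.exp (P₅ + P₆ + P₇) := by
  rw [Real.exp_add, Real.exp_add]; ring

/-- **The pointwise identity behind Wood's construction**: on `(−1, 1)`, proposal density × acceptance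
probability `= K × (1−w²)^{δ/2−1} e^{κw}` — every power of `D(w) = (1+b)(1 − x₀w)` cancels because
`2α = δ`. -/
theorem wood_pointwise (hκ : 0 ≤ κ) (hδ : 0 < δ) {w : ℝ} (hw : w ∈ Ioo (-1 : ℝ) 1) :
    ENNReal.ofReal (betaPDFReal (δ / 2) (δ / 2) (woodZ (woodB κ δ) w) *
        (2 * woodB κ δ / woodD (woodB κ δ) w ^ 2)) * woodAccept κ δ w =
      woodConst κ δ * ENNReal.ofReal ((1 - w ^ 2) ^ (δ / 2 - 1) * Real.exp (κ * w)) := by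
  have hb := woodB_pos hκ hδ
  have hb1 := woodB_le_one hκ hδ
  have hZ := woodZ_mem hb hb1 hw
  have hD := woodD_pos hb hb1 hw.2.le
  have h1w : 0 < 1 - w := by linarith [hw.2]
  have h1w' : 0 < 1 + w := by linarith [hw.1]
  have hB := beta_pos (by positivity : 0 < δ / 2) (by positivity : 0 < δ / 2)
  have hx : 1 - woodX0 κ δ * w = woodD (woodB κ δ) w / (1 + woodB κ δ) := by
    rw [woodX0, woodD, eq_div_iff (by linarith)]
    field_simp
  rw [woodAccept_eq hκ hδ ⟨hw.1.le, hw.2.le⟩, woodConst, ← ENNReal.ofReal_mul (by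
      have := betaPDFReal_pos hZ.1 hZ.2 (by positivity : 0 < δ / 2) (by positivity : 0 < δ / 2)
      positivity), ← ENNReal.ofReal_mul (by positivity)]
  congr 1
  -- `2b/D²` in exponential form
  have hD2 : Real.exp (2 * Real.log (woodD (woodB κ δ) w)) = woodD (woodB κ δ) w ^ 2 := by
    rw [show (2 : ℝ) * Real.log (woodD (woodB κ δ) w) = ((2 : ℕ) : ℝ) * Real.log (woodD (woodB κ δ) w) by
      norm_num, Real.exp_nat_mul, Real.exp_log hD]
  have h2b : 2 * woodB κ δ / woodD (woodB κ δ) w ^ 2 =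
      2 * Real.exp (Real.log (woodB κ δ) - 2 * Real.log (woodD (woodB κ δ) w)) := by
    rw [Real.exp_sub, Real.exp_log hb, hD2]; ring
  rw [h2b]
  -- everything in exponential form
  rw [betaPDFReal, if_pos ⟨hZ.1, hZ.2⟩, woodH, hx, one_sub_woodZ hb hb1 hw.2.le,
    show woodZ (woodB κ δ) w = (1 - w) / woodD (woodB κ δ) w from rfl,
    Real.rpow_def_of_pos (div_pos h1w hD), Real.rpow_def_of_pos (by positivity),
    Real.rpow_def_of_pos (by nlinarith : (0 : ℝ) < 1 - w ^ 2),
    Real.log_div h1w.ne' hD.ne', Real.log_div (by positivity) hD.ne', Real.log_mul hb.ne' h1w'.ne',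
    Real.log_div hD.ne' (by linarith), show (1 : ℝ) - w ^ 2 = (1 - w) * (1 + w) by ring,
    Real.log_mul h1w.ne' h1w'.ne']
  rw [exp_combine4, exp_combine3]
  congr 1
  congr 1
  ring

/-! ## §4 The loop -/

/-- **One Wood round**: propose `W(Z)`, `Z ∼ Beta(δ/2, δ/2)`, accept with probability `woodAccept`. -/
noncomputable def woodRound (κ δ : ℝ) : Measure (ℝ × Bool) :=
  ((betaMeasure (δ / 2) (δ / 2)).map (woodW (woodB κ δ))) ⊗ₘ coin (woodAccept κ δ)

/-- The accepted part of the proposal law is `K • vmfCosLaw`. -/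
theorem withDensity_woodProposal (hκ : 0 ≤ κ) (hδ : 0 < δ) :
    ((betaMeasure (δ / 2) (δ / 2)).map (woodW (woodB κ δ))).withDensity (woodAccept κ δ) =
      woodConst κ δ • vmfCosLaw κ δ := by
  have hb := woodB_pos hκ hδ
  have hb1 := woodB_le_one hκ hδ
  ext A hA
  rw [withDensity_apply _ hA, Measure.smul_apply, smul_eq_mul, vmfCosLaw, withDensity_apply _ hA,
    Measure.restrict_restrict hA, ← lintegral_indicator hA,
    lintegral_map ((measurable_woodAccept κ δ).indicator hA) (measurable_woodW _),
    lintegral_woodW hb hb1 ((measurable_woodAccept κ δ).indicator hA)]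
  -- both sides as integrals over `A ∩ (−1, 1)`
  have hL : ∫⁻ w in Ioo (-1) 1, ENNReal.ofReal (betaPDFReal (δ / 2) (δ / 2) (woodZ (woodB κ δ) w) *
      (2 * woodB κ δ / woodD (woodB κ δ) w ^ 2)) * A.indicator (woodAccept κ δ) w =
      ∫⁻ w in A ∩ Ioo (-1) 1, ENNReal.ofReal (betaPDFReal (δ / 2) (δ / 2) (woodZ (woodB κ δ) w) *
      (2 * woodB κ δ / woodD (woodB κ δ) w ^ 2)) * woodAccept κ δ w := by
    rw [← Measure.restrict_restrict hA, ← lintegral_indicator hA]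
    refine lintegral_congr fun w => ?_
    by_cases h : w ∈ A
    · rw [indicator_of_mem h, indicator_of_mem h]
    · rw [indicator_of_notMem h, indicator_of_notMem h, mul_zero]
  have hKt : woodConst κ δ ≠ ∞ := ENNReal.ofReal_ne_top
  rw [hL, ← lintegral_const_mul' (woodConst κ δ) _ hKt]
  refine setLIntegral_congr_fun (hA.inter measurableSet_Ioo) fun w hw => ?_
  exact wood_pointwise hκ hδ hw.2

/-- **Cost**: one Wood round accepts with probability `K · vmfCosLaw κ δ ℝ`. -/
theorem woodRound_accept (hκ : 0 ≤ κ) (hδ : 0 < δ) :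
    woodRound κ δ (univ ×ˢ {true}) = woodConst κ δ * vmfCosLaw κ δ univ := by
  haveI : IsProbabilityMeasure (betaMeasure (δ / 2) (δ / 2)) :=
    isProbabilityMeasureBeta (by positivity) (by positivity)
  rw [woodRound, thinning_accept _ (measurable_woodAccept κ δ) (woodAccept_le_one κ δ),
    ← setLIntegral_univ, ← withDensity_apply _ MeasurableSet.univ, withDensity_woodProposal hκ hδ,
    Measure.smul_apply, smul_eq_mul]

/-- **WOOD'S LOOP IS EXACT.**  For `κ ≥ 0`, `δ > 0`, repeating the round until the first acceptance
outputs the normalised law `(vmfCosLaw κ δ ℝ)⁻¹ • vmfCosLaw κ δ`, i.e. density `∝ (1−w²)^{(d−3)/2} e^{κw}`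
on `(−1, 1)` with `δ = d − 1`. -/
theorem loopLaw_woodRound (hκ : 0 ≤ κ) (hδ : 0 < δ) :
    loopLaw (woodRound κ δ) = (vmfCosLaw κ δ univ)⁻¹ • vmfCosLaw κ δ := by
  haveI : IsProbabilityMeasure (betaMeasure (δ / 2) (δ / 2)) :=
    isProbabilityMeasureBeta (by positivity) (by positivity)
  haveI : IsProbabilityMeasure ((betaMeasure (δ / 2) (δ / 2)).map (woodW (woodB κ δ))) :=
    isProbabilityMeasure_map (measurable_woodW _).aemeasurable
  have hK0 := woodConst_ne_zero (κ := κ) hδ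
  have hKt : woodConst κ δ ≠ ∞ := ENNReal.ofReal_ne_top
  rw [woodRound, loopLaw_thinning _ (measurable_woodAccept κ δ) (woodAccept_le_one κ δ),
    ← setLIntegral_univ, ← withDensity_apply _ MeasurableSet.univ, withDensity_woodProposal hκ hδ,
    Measure.smul_apply, smul_eq_mul, smul_smul, ENNReal.mul_inv (Or.inl hK0) (Or.inl hKt),
    mul_comm (woodConst κ δ)⁻¹, mul_assoc, ENNReal.inv_mul_cancel hK0 hKt, mul_one]

end WoodLoop

end Summit.Ventures.LatticeQCDFlow.Exactness
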